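import Summits.FinalStateConjecture.FinalStateConjecture.Theses.TangentConeAtIPlus

/-!
# Relabelling toolkit and hypothesis for the negative lemma on `KerrCaptureOnRays` (stmt-FinalStateConjecture-17669)

Support file (no route item is asserted): the periodic piecewise-linear BLIP `blip θ` used to relabel the rest-time
parameter of a cone datum's drift, its elementary properties (continuity via `Int.fract`, bounds, fold witnesses,
surjectivity of `s ↦ s + blip θ s`, survival of sublinearity, the two-phase cleanliness dichotomy), a little
rest-frame / Kerr–Schild bookkeeping in `E4`, two real-arithmetic estimates, VERBATIM copies `Cone`, `Holes`,
`Window` of the `let`-bound predicates of `Theses/TangentConeAtIPlus.lean` (so that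
`KerrCaptureOnRays ↔ ∀ …, Cone … → ∃ …, Holes …` holds by `Iff.rfl`, `kerrCaptureOnRays_iff`), and the hypothesis
`NonDispersiveConeData` ("some admissible MGHD carries cone data with a hole").  Consumed by
`KerrCaptureOnRaysFalseOfNonDispersiveConeData.lean` in the same directory (the negative lemma
`KerrCaptureOnRays_false_of_NonDispersiveConeData : NonDispersiveConeData → ¬ KerrCaptureOnRays`).
-/

set_option linter.dupNamespace false

noncomputable section

namespace Summit.FinalStateConjecture.FinalStateConjecture.Theorems.KerrCaptureOnRays.Negative

open scoped BigOperators Topology Manifold Classical MeasureTheory ProbabilityTheory Matrix InnerProductSpace ComplexConjugate ContinuousMap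
open Filter Set Function TopologicalSpace MeasureTheory
open Literature.Geometry.Lorentzian
open scoped ContDiff ENNReal

/-! ## The relabelling blip -/

/-- The periodic piecewise-linear blip of phase `θ`: height `≤ 2`, supported on
`⋃ₖ (θ + 100k + 10, θ + 100k + 12)`, with descending slope `-2` (so `s ↦ s + blip θ s` folds). -/
def blip (θ s : ℝ) : ℝ := max 0 (2 - 2 * |100 * Int.fract ((s - θ) / 100) - 11|)

/-- The blip is nonnegative. -/
theorem blip_nonneg (θ s : ℝ) : 0 ≤ blip θ s := le_max_left _ _

/-- The blip is at most `2`. -/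
theorem blip_le_two (θ s : ℝ) : blip θ s ≤ 2 := by
  unfold blip
  refine max_le (by norm_num) ?_
  linarith [abs_nonneg (100 * Int.fract ((s - θ) / 100) - 11)]

/-- The blip has absolute value at most `2`. -/
theorem abs_blip_le_two (θ s : ℝ) : |blip θ s| ≤ 2 := by
  rw [abs_of_nonneg (blip_nonneg θ s)]
  exact blip_le_two θ s

/-- The blip is continuous (a continuous function of `Int.fract` agreeing at `0` and `1`). -/
theorem continuous_blip (θ : ℝ) : Continuous (blip θ) := by
  have h : Continuous fun s : ℝ => (fun u : ℝ => max 0 (2 - 2 * |100 * u - 11|)) (Int.fract ((s - θ) / 100)) := by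
    refine ContinuousOn.comp_fract (f := fun (_ : ℝ) (u : ℝ) => max 0 (2 - 2 * |100 * u - 11|)) ?_ ?_ ?_
    · exact Continuous.continuousOn (by fun_prop)
    · fun_prop
    · intro s
      norm_num [abs_of_neg, abs_of_pos]
  exact h

/-- Off its support the blip vanishes: `blip θ s ≠ 0` forces `100·fract((s-θ)/100) ∈ (10, 12)`. -/
theorem abs_lt_one_of_blip_ne_zero {θ s : ℝ} (h : blip θ s ≠ 0) :
    |100 * Int.fract ((s - θ) / 100) - 11| < 1 := by
  by_contra hle
  push Not at hle
  apply h
  unfold blip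
  exact max_eq_left (by linarith)

/-- On every window of half-width `1`, one of the two phases `0`, `50` is switched off. -/
theorem blip_clean_or (τ : ℝ) :
    (∀ s, |s - τ| ≤ 1 → blip 0 s = 0) ∨ (∀ s, |s - τ| ≤ 1 → blip 50 s = 0) := by
  by_contra h
  rw [not_or] at h
  obtain ⟨h0, h50⟩ := h
  push Not at h0 h50
  obtain ⟨s₀, hs₀, hb₀⟩ := h0
  obtain ⟨s₁, hs₁, hb₁⟩ := h50
  have hu₀ := abs_lt_one_of_blip_ne_zero hb₀
  have hu₁ := abs_lt_one_of_blip_ne_zero hb₁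
  rw [sub_zero] at hu₀
  have e₀ : ((⌊s₀ / 100⌋ : ℤ) : ℝ) + Int.fract (s₀ / 100) = s₀ / 100 := Int.floor_add_fract _
  have e₁ : ((⌊(s₁ - 50) / 100⌋ : ℤ) : ℝ) + Int.fract ((s₁ - 50) / 100) = (s₁ - 50) / 100 :=
    Int.floor_add_fract _
  rw [abs_lt] at hu₀ hu₁
  rw [abs_le] at hs₀ hs₁
  set z : ℤ := ⌊s₀ / 100⌋ - ⌊(s₁ - 50) / 100⌋ with hz
  have hzR : (z : ℝ) = ((⌊s₀ / 100⌋ : ℤ) : ℝ) - ((⌊(s₁ - 50) / 100⌋ : ℤ) : ℝ) := by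
    rw [hz]; push_cast; ring
  rcases le_or_gt z 0 with hz0 | hz1
  · have : (z : ℝ) ≤ 0 := by exact_mod_cast hz0
    linarith
  · have : (1 : ℝ) ≤ z := by exact_mod_cast hz1
    linarith

/-- Values of the blip at the two fold witnesses of period `k`. -/
theorem blip_wit₁ (θ : ℝ) (k : ℕ) : blip θ (θ + 100 * k + 43 / 4) = 3 / 2 := by
  unfold blip
  have : (θ + 100 * k + 43 / 4 - θ) / 100 = (k : ℤ) + 43 / 400 := by push_cast; ring
  rw [this, Int.fract_intCast_add, Int.fract_eq_self.mpr ⟨by norm_num, by norm_num⟩]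
  norm_num [abs_of_neg]

/-- Value of the blip at the second fold witness of period `k`. -/
theorem blip_wit₂ (θ : ℝ) (k : ℕ) : blip θ (θ + 100 * k + 47 / 4) = 1 / 2 := by
  unfold blip
  have : (θ + 100 * k + 47 / 4 - θ) / 100 = (k : ℤ) + 47 / 400 := by push_cast; ring
  rw [this, Int.fract_intCast_add, Int.fract_eq_self.mpr ⟨by norm_num, by norm_num⟩]
  norm_num [abs_of_pos]

/-- The relabelling `s ↦ s + blip θ s` is onto. -/
theorem add_blip_surjective (θ : ℝ) : Function.Surjective fun s : ℝ => s + blip θ s := by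
  intro v
  have hcont : ContinuousOn (fun s : ℝ => s + blip θ s) (Icc (v - 2) v) :=
    (continuous_id.add (continuous_blip θ)).continuousOn
  have hmem : v ∈ Icc ((v - 2) + blip θ (v - 2)) (v + blip θ v) :=
    ⟨by linarith [blip_le_two θ (v - 2)], by linarith [blip_nonneg θ v]⟩
  obtain ⟨s, -, hs⟩ := intermediate_value_Icc (by linarith) hcont hmem
  exact ⟨s, hs⟩

/-- The relabelling `s ↦ s + blip θ s` tends to `+∞`. -/
theorem tendsto_add_blip_atTop (θ : ℝ) : Tendsto (fun s : ℝ => s + blip θ s) atTop atTop :=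
  tendsto_atTop_mono (fun s => le_add_of_nonneg_right (blip_nonneg θ s)) tendsto_id

/-- Sublinearity survives the relabelling. -/
theorem tendsto_sublinear_relabel {σ₀ : ℝ → ℝ} {dr₀ : ℝ → E4} (θ : ℝ) (v : E4)
    (h : Tendsto (fun s : ℝ => (|σ₀ s| + ‖dr₀ s‖) / s) atTop (𝓝 0)) :
    Tendsto (fun s : ℝ => (|σ₀ (s + blip θ s)| + ‖dr₀ (s + blip θ s) + blip θ s • v‖) / s)
      atTop (𝓝 0) := by
  set G : ℝ → ℝ := fun s => s + blip θ s with hG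
  have hGt : Tendsto G atTop atTop := tendsto_add_blip_atTop θ
  have hFG : Tendsto (fun s => (|σ₀ (G s)| + ‖dr₀ (G s)‖) / G s) atTop (𝓝 0) := h.comp hGt
  have hup : Tendsto (fun s : ℝ => 3 * ((|σ₀ (G s)| + ‖dr₀ (G s)‖) / G s) + 2 * ‖v‖ * s⁻¹)
      atTop (𝓝 0) := by
    have := (hFG.const_mul 3).add ((tendsto_inv_atTop_zero (𝕜 := ℝ)).const_mul (2 * ‖v‖))
    simpa using this
  refine tendsto_of_tendsto_of_tendsto_of_le_of_le' tendsto_const_nhds hup ?_ ?_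
  · filter_upwards [eventually_ge_atTop (1 : ℝ)] with s hs
    positivity
  · filter_upwards [eventually_ge_atTop (1 : ℝ)] with s hs
    have hGs : s ≤ G s := le_add_of_nonneg_right (blip_nonneg θ s)
    have hG0 : 0 < G s := by linarith
    have hG3 : G s / s ≤ 3 := by
      rw [div_le_iff₀ (by linarith)]
      have := blip_le_two θ s
      simp only [hG]; linarith
    have hnum : |σ₀ (G s)| + ‖dr₀ (G s) + blip θ s • v‖ ≤ (|σ₀ (G s)| + ‖dr₀ (G s)‖) + 2 * ‖v‖ := by
      have h1 : ‖dr₀ (G s) + blip θ s • v‖ ≤ ‖dr₀ (G s)‖ + ‖blip θ s • v‖ := norm_add_le _ _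
      have h2 : ‖blip θ s • v‖ ≤ 2 * ‖v‖ := by
        rw [norm_smul, Real.norm_eq_abs]
        exact mul_le_mul_of_nonneg_right (abs_blip_le_two θ s) (norm_nonneg _)
      linarith
    have hAB : 0 ≤ (|σ₀ (G s)| + ‖dr₀ (G s)‖) / G s := by positivity
    calc (|σ₀ (G s)| + ‖dr₀ (G s) + blip θ s • v‖) / s
        ≤ ((|σ₀ (G s)| + ‖dr₀ (G s)‖) + 2 * ‖v‖) / s := by
          exact div_le_div_of_nonneg_right hnum (by linarith)
      _ = ((|σ₀ (G s)| + ‖dr₀ (G s)‖) / G s) * (G s / s) + 2 * ‖v‖ * s⁻¹ := by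
          field_simp
      _ ≤ ((|σ₀ (G s)| + ‖dr₀ (G s)‖) / G s) * 3 + 2 * ‖v‖ * s⁻¹ := by
          gcongr
      _ = 3 * ((|σ₀ (G s)| + ‖dr₀ (G s)‖) / G s) + 2 * ‖v‖ * s⁻¹ := by ring

/-! ## Rest-frame bookkeeping -/

/-- Rest-frame coordinates of `c + Λ ξ` are `ξ`. -/
theorem poincareInv_add_apply (Λ : lorentzGroup) (c ξ : E4) :
    poincareInv Λ c (c + (Λ : E4 ≃L[ℝ] E4) ξ) = ξ := by
  simp [poincareInv]

/-- Kerr–Schild radius of an equatorial point at Euclidean distance `ρ ≥ |a|`. -/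
theorem radius_sq_of_equatorial {a : ℝ} {ξ : E4} (h3 : ξ 3 = 0) (hρ : |a| ≤ E4.spatialNorm ξ) :
    Kerr.radius a ξ ^ 2 = E4.spatialNorm ξ ^ 2 - a ^ 2 := by
  rw [Kerr.radius_sq, h3]
  have hnn : 0 ≤ E4.spatialNorm ξ ^ 2 - a ^ 2 := by
    have := sq_le_sq' (by linarith [abs_nonneg a, neg_abs_le a]) hρ
    nlinarith [sq_abs a]
  rw [show (E4.spatialNorm ξ ^ 2 - a ^ 2) ^ 2 + 4 * a ^ 2 * (0 : ℝ) ^ 2 =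
      (E4.spatialNorm ξ ^ 2 - a ^ 2) ^ 2 by ring, Real.sqrt_sq hnn]
  ring

/-! ## Abstract dichotomy for recurrent windows -/

/-- If a property recurs at arbitrarily late times for every tolerance `ε > 0` (monotonically in `ε`), and every time is CLEAN for one of two tests, then for one FIXED test the property recurs at clean times for every `ε`. -/
theorem recurrent_dichotomy {P : ℝ≥0∞ → ℝ → Prop} {C₀ C₁ : ℝ → Prop}
    (hmono : ∀ ε ε' τ, ε ≤ ε' → P ε τ → P ε' τ)
    (hrec : ∀ ε, 0 < ε → ∀ τ₁, ∃ τ, τ₁ ≤ τ ∧ P ε τ) (hC : ∀ τ, C₀ τ ∨ C₁ τ) :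
    (∀ ε, 0 < ε → ∀ τ₁, ∃ τ, τ₁ ≤ τ ∧ C₀ τ ∧ P ε τ) ∨
      (∀ ε, 0 < ε → ∀ τ₁, ∃ τ, τ₁ ≤ τ ∧ C₁ τ ∧ P ε τ) := by
  by_contra h
  rw [not_or] at h
  obtain ⟨hA, hB⟩ := h
  push Not at hA hB
  obtain ⟨ε₀, hε₀, τa, hA⟩ := hA
  obtain ⟨ε₁, hε₁, τb, hB⟩ := hB
  obtain ⟨τ, hτ, hP⟩ := hrec (min ε₀ ε₁) (lt_min hε₀ hε₁) (max τa τb)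
  rcases hC τ with hc | hc
  · exact hA τ (le_of_max_le_left hτ) hc (hmono _ _ _ (min_le_left _ _) hP)
  · exact hB τ (le_of_max_le_right hτ) hc (hmono _ _ _ (min_le_right _ _) hP)


/-- `(0, ρ e₁) = ρ • (0, e₁)` in `E4`. -/
theorem ofTimeSpace_zero_single (ρ : ℝ) :
    E4.ofTimeSpace 0 (EuclideanSpace.single 0 ρ) = ρ • E4.ofTimeSpace 0 (EuclideanSpace.single 0 1) := by
  ext i
  refine Fin.cases ?_ (fun j => ?_) i
  · simp
  · rw [PiLp.smul_apply, E4.ofTimeSpace_apply_succ, E4.ofTimeSpace_apply_succ]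
    by_cases hj : j = 0
    · subst hj; simp
    · simp [hj]

/-- Flat-time bookkeeping: the glued annulus point is later than `T + 1` once the fold is late enough. -/
theorem flat_time_gt {c0 κ u0 σv ndr d0 v T : ℝ} (hκ : 0 < κ) (hv1 : 1 ≤ v)
    (hsl : |σv| + ndr ≤ κ / (2 * (|u0| + 1)) * v) (hd0 : |d0| ≤ ndr)
    (hB : 2 * (|T + 1 - c0| + 2 * |u0|) / κ + 1 ≤ v) :
    T + 1 < c0 + v * κ + (σv + 2) * u0 + d0 := by
  have hu0 : 0 ≤ |u0| := abs_nonneg _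
  have hA : -((|σv| + 2) * |u0|) ≤ (σv + 2) * u0 := by
    have h1 : |(σv + 2) * u0| = |σv + 2| * |u0| := abs_mul _ _
    have h2 : |σv + 2| ≤ |σv| + 2 := by simpa using abs_add_le σv 2
    have h3 := neg_abs_le ((σv + 2) * u0)
    nlinarith
  have hBd : -ndr ≤ d0 := by linarith [neg_abs_le d0]
  have hpos : 0 < 2 * (|u0| + 1) := by positivity
  have hE : 2 * (|u0| + 1) * (|σv| + ndr) ≤ κ * v := by
    have := mul_le_mul_of_nonneg_left hsl hpos.le
    have hcancel : 2 * (|u0| + 1) * (κ / (2 * (|u0| + 1)) * v) = κ * v := by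
      field_simp
    linarith
  have hF : 2 * (|T + 1 - c0| + 2 * |u0|) ≤ κ * (v - 1) := by
    have : 2 * (|T + 1 - c0| + 2 * |u0|) / κ ≤ v - 1 := by linarith
    rw [div_le_iff₀ hκ] at this
    linarith
  have hG : T + 1 - c0 ≤ |T + 1 - c0| := le_abs_self _
  have hndr : 0 ≤ ndr := (abs_nonneg _).trans hd0
  nlinarith [mul_nonneg hu0 hndr, abs_nonneg σv, mul_nonneg hu0 (abs_nonneg σv)]

/-- Radius bookkeeping: `r₊² < ρ² - a²` once `ρ ≥ r₊ + |a| + 2`. -/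
theorem sq_lt_sq_sub {R a ρ : ℝ} (hR : 0 ≤ R) (h : R + |a| + 2 ≤ ρ) : R ^ 2 < ρ ^ 2 - a ^ 2 := by
  have ha := abs_nonneg a
  rw [← sq_abs a]
  nlinarith [mul_nonneg hR ha]

/-! ## The cone and hole predicates of the route (verbatim copies of the `let`-bound predicates) -/

/-- The CONE predicate shared by the items of route `TangentConeAtIPlus` — verbatim the `let Cone := …` of
`Theses/TangentConeAtIPlus.lean` (so that `KerrCaptureOnRays` unfolds to `∀ …, Cone … → ∃ …, Holes …` by `Iff.rfl`,
see `kerrCaptureOnRays_iff`). -/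
def Cone (𝓢 : Spacetime.{0} 4) (S : Set 𝓢.carrier) (N : ℕ) (mo : Fin N → lorentzGroup × E4) (σ : Fin N → ℝ → ℝ) (dr : Fin N → ℝ → E4) (T : ℝ) (U : Opens E4) (Φ : U → 𝓢.carrier) : Prop :=
  let t := fun i (x : E4) => poincareInv (mo i).1 (mo i).2 x 0; let d := fun i (x : E4) => E4.spatialNorm (poincareInv (mo i).1 (mo i).2 x); let tube := fun i (w : ℝ) => (fun x ↦ x + dr i (t i x)) '' {x : E4 | d i x ≤ σ i (t i x) + w} ∩ {y | T < y 0}; let F := Minkowski.backgroundOn U; (∀ i, Summit.FinalStateConjecture.IsOrthochronous (mo i).1 ∧ Continuous (σ i) ∧ Continuous (dr i) ∧ Tendsto (fun s : ℝ ↦ (|σ i s| + ‖dr i s‖) / s) atTop (𝓝 0) ∧ Tendsto (σ i) atTop atTop) ∧ (∀ i j, i ≠ j → Disjoint (tube i 5) (tube j 5)) ∧ {y : E4 | T < y 0} \ (⋃ i, tube i 0) ⊆ (U : Set E4) ∧ 𝓢.IsLateChart F (𝓢.metric.causalFuture 𝓢.timeOrientation S) T Φ ∧ (∀ x : U, 𝓢.timeOrientation.IsFutureDirected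 (mfderiv 𝓘(ℝ, E4) (𝓡 4) Φ x (EuclideanSpace.single 0 1))) ∧ (∀ δ : ℝ, 0 < δ → Tendsto (fun τ : ℝ ↦ weightedCkSeminorm {x : E4 | x 0 = τ ∧ E4.spatialNorm x ≤ (1 - δ) * τ ∧ ∀ i, δ * τ ≤ d i x} 2 0 (𝓢.deviationExtend F Φ)) atTop (𝓝 0)) ∧ Tendsto (fun τ : ℝ ↦ 𝓢.deviationCk F Φ 2 τ) atTop (𝓝 0) ∧ (∀ i, ∃ M a : ℝ, Kerr.IsSubextremal M a ∧ ∀ ε : ENNReal, 0 < ε → ∀ τ₁ : ℝ, ∃ τ : ℝ, τ₁ ≤ τ ∧ (let B := boostedKerrBackground (mo i).1 (mo i).2 M a; ∃ Ψ : B.domain → 𝓢.carrier, ContMDiff 𝓘(ℝ, E4) (𝓡 4) ∞ Ψ ∧ Topology.IsOpenEmbedding ({x : B.domain | |t i x.1 - τ| < 1 ∧ d i x.1 < σ i (t i x.1) + |a| + 6}.restrict Ψ) ∧ (∀ x : B.domain, |t i x.1 - τ| < 1 → σ i (t i x.1) + 1 ≤ d i x.1 → d i x.1 < σ i (t i x.1)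 + 4 → ∃ hx : x.1 + dr i (t i x.1) ∈ (U : Set E4), Ψ x = Φ ⟨_, hx⟩) ∧ 𝓢.truncDeviationCk B Ψ 2 (σ i τ + 5) τ ≤ ε))

/-- The HOLE predicate of `KerrCaptureOnRays` — verbatim the `let Holes := …` of `Theses/TangentConeAtIPlus.lean`. -/
def Holes (𝓢 : Spacetime.{0} 4) (S : Set 𝓢.carrier) (N : ℕ) (mo : Fin N → lorentzGroup × E4) (σ : Fin N → ℝ → ℝ) (dr : Fin N → ℝ → E4) (T : ℝ) (U : Opens E4) (Φ : U → 𝓢.carrier) (M a : Fin N → ℝ) (τ₀ : ℝ) : (∀ i, (boostedKerrBackground (mo i).1 (mo i).2 (M i) (a i)).domain → 𝓢.carrier) → Prop :=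
  let B := fun i => boostedKerrBackground (mo i).1 (mo i).2 (M i) (a i); fun (Ψ : ∀ i, (B i).domain → 𝓢.carrier) => let t := fun i (x : E4) => poincareInv (mo i).1 (mo i).2 x 0; let d := fun i (x : E4) => E4.spatialNorm (poincareInv (mo i).1 (mo i).2 x); let W := fun i => {x : (B i).domain | τ₀ < t i x.1 ∧ d i x.1 < σ i (t i x.1) + |a i| + 6}; (∀ i, Kerr.IsSubextremal (M i) (a i)) ∧ T ≤ τ₀ ∧ (∀ i, ContMDiff 𝓘(ℝ, E4) (𝓡 4) ∞ (Ψ i) ∧ Topology.IsOpenEmbedding ((W i).restrict (Ψ i)) ∧ Ψ i '' W i ⊆ 𝓢.metric.causalFuture 𝓢.timeOrientation S) ∧ (∀ i (r : ℝ), Tendsto (fun τ : ℝ ↦ 𝓢.truncDeviationCk (B i) (Ψ i) 2 r τ) atTop (𝓝 0)) ∧ (∀ i, Tendsto (fun τ : ℝ ↦ 𝓢.truncDeviationCk (B i) (Ψ i) 2 (σ i τ + 5) τ) atTop (𝓝 0)) ∧ (∀ i (x : (B i).domain), τ₀ < t i x.1 → σ i (t i x.1) + 1 ≤ d i x.1 →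 d i x.1 < σ i (t i x.1) + 4 → T + 1 < (x.1 + dr i (t i x.1)) 0 → ∃ hx : x.1 + dr i (t i x.1) ∈ (U : Set E4), Ψ i x = Φ ⟨_, hx⟩) ∧ (∀ r : ℝ, ∃ τ₁ : ℝ, Pairwise (Function.onFun Disjoint fun i ↦ Ψ i '' (B i).truncLateRegion τ₁ r))

/-- The recurrent BASIN WINDOW of hole `i` at rest time `τ` with tolerance `ε` (verbatim the last sub-clause of
`Cone`). -/
def Window (𝓢 : Spacetime.{0} 4) (N : ℕ) (mo : Fin N → lorentzGroup × E4) (σ : Fin N → ℝ → ℝ) (dr : Fin N → ℝ → E4) (U : Opens E4) (Φ : U → 𝓢.carrier) (i : Fin N) (M a : ℝ) (ε : ℝ≥0∞) (τ : ℝ) : Prop :=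
  let t := fun i (x : E4) => poincareInv (mo i).1 (mo i).2 x 0; let d := fun i (x : E4) => E4.spatialNorm (poincareInv (mo i).1 (mo i).2 x); (let B := boostedKerrBackground (mo i).1 (mo i).2 M a; ∃ Ψ : B.domain → 𝓢.carrier, ContMDiff 𝓘(ℝ, E4) (𝓡 4) ∞ Ψ ∧ Topology.IsOpenEmbedding ({x : B.domain | |t i x.1 - τ| < 1 ∧ d i x.1 < σ i (t i x.1) + |a| + 6}.restrict Ψ) ∧ (∀ x : B.domain, |t i x.1 - τ| < 1 → σ i (t i x.1) + 1 ≤ d i x.1 → d i x.1 < σ i (t i x.1) + 4 → ∃ hx : x.1 + dr i (t i x.1) ∈ (U : Set E4), Ψ x = Φ ⟨_, hx⟩) ∧ 𝓢.truncDeviationCk B Ψ 2 (σ i τ + 5) τ ≤ ε)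

/-- `KerrCaptureOnRays` is, by `Iff.rfl`, "cone data ⇒ hole data" in terms of the verbatim copies above. -/
theorem kerrCaptureOnRays_iff :
    Summit.FinalStateConjecture.FinalStateConjecture.Theses.TangentConeAtIPlus.KerrCaptureOnRays ↔
    ∀ (X : Type) [TopologicalSpace X] [ChartedSpace E3 X] [IsManifold (𝓡 3) ∞ X] [T2Space X] [SecondCountableTopology X] [ConnectedSpace X] (D : InitialDataSet (𝓡 3) X), D ∈ admissibleVacuumData X → ∀ 𝒟 : VacuumCauchyDevelopment D, 𝒟.IsMaximal → ∀ (N : ℕ) (mo : Fin N → lorentzGroup × E4) (σ : Fin N → ℝ → ℝ) (dr : Fin N → ℝ → E4) (T : ℝ) (U : Opens E4) (Φ : U → 𝒟.carrier), Cone 𝒟.toSpacetime (range 𝒟.embed) N mo σ dr T U Φ → ∃ (M a : Fin N → ℝ) (τ₀ : ℝ) (Ψ : ∀ i, (boostedKerrBackground (mo i).1 (mo i).2 (M i) (a i)).domain → 𝒟.carrier), Holes 𝒟.toSpacetime (range 𝒟.embed) N mo σ dr T U Φ M a τ₀ Ψ :=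
  Iff.rfl

/-! ## The hypothesis `NonDispersiveConeData` -/

/-- **Hypothesis `NonDispersiveConeData` (NOT constructible in the tree; filed `--negative-modulo`).** Some
admissible vacuum datum has a maximal vacuum Cauchy development carrying CONE DATA WITH AT LEAST ONE HOLE in the
sense of route `TangentConeAtIPlus` (the hypothesis of `KerrCaptureOnRays` / conclusion of `FiniteKerrParticleCone`
for one datum, with `0 < N`).  Mathematically this is the expected behaviour of every development forming a
sub-extremal black hole that settles down (e.g. one-ended data with a trapped surface, Li–Yu 2015, plus sub-extremal
Kerr stability, Hintz arXiv:2606.28253 / Klainerman–Szeftel 2023); in the tree it needs an MGHD containing a black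
hole, which nobody can construct (Choquet-Bruhat–Geroch is itself the named fact
`choquetBruhat_geroch_exists_mghd_cauchy`, and the only inhabited development is Minkowski's, on which the basin
clause forces `N = 0`).  CHEAPEST ROAD TO `H` (for whoever takes the construction item): a complete one-ended
admissible datum that is EXACTLY sub-extremal Kerr–Schild slice data on `{r ≥ r₀}` for some `r₋ < r₀ < r₊` (interior
fill-in across a trapped annulus by constraint gluing); its MGHD then contains the exact Kerr region
`{t* ≥ 0, r > r₀}` by domain of dependence (inside `r₋ < r < r₊` the radius decreases along future causal curves and
the black hole is a future set), and exact-Kerr cone data (`N = 1`, `Λ = 1`, `c = 0`, `dr = 0`, `σ t = √t`, `Φ` the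
Kerr–Schild chart, `T > 4M²` so that the ergoregion sits inside the tube) satisfy `Cone` — no stability theorem is
needed. -/
def NonDispersiveConeData : Prop :=
  ∃ (X : Type) (_ : TopologicalSpace X) (_ : ChartedSpace E3 X) (_ : IsManifold (𝓡 3) ∞ X)
    (_ : T2Space X) (_ : SecondCountableTopology X) (_ : ConnectedSpace X)
    (D : InitialDataSet (𝓡 3) X) (_ : D ∈ admissibleVacuumData X)
    (𝒟 : VacuumCauchyDevelopment D) (_ : 𝒟.IsMaximal)
    (N : ℕ) (mo : Fin N → lorentzGroup × E4) (σ : Fin N → ℝ → ℝ) (dr : Fin N → ℝ → E4) (T : ℝ)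
    (U : Opens E4) (Φ : U → 𝒟.carrier),
    0 < N ∧ Cone 𝒟.toSpacetime (range 𝒟.embed) N mo σ dr T U Φ

end Summit.FinalStateConjecture.FinalStateConjecture.Theorems.KerrCaptureOnRays.Negative

end
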